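import Literature.MathematicalPhysics.QuantumFieldTheory.Balaban1983to89.DagDischargedII
import Literature.MathematicalPhysics.QuantumFieldTheory.Balaban1983to89.B11Prop7Assembly

/-!
# `Balaban1983to89.B11Prop7AssemblyThresholds` — T. Bałaban, *The variational problem and background fields in renormalization group
# method for lattice gauge theories*, Commun. Math. Phys. **102** (1985) 277–309, doi:10.1007/bf01229381
# [Balaban1985Variational]: **Proposition 7 (p. 299), Theorem 1 (p. 279) and the B11 leaf assembled from Props 2, 5, 6 with the located
# existence leaves of pp. 296–299 in THRESHOLDED form** — the steps (112) ↦ critical U₁ in (19)–(21), «Proposition 7 [6]» ↦ U_k in (18),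
# (141)–(142) ↦ minimal are asked only for ε₁, ε₂ below a threshold `c`, as their printed sources are ([Balaban1985RegularSpaces] Prop. 7
# p. 100: «α₀, α₂ ≤ c»; (123)–(140) for small ε₁; the chart (47)/(112) is defined and one-to-one near 0 only, Prop. 3 p. 289)

statement-level bookkeeping over published theorems with citation tags; proofs = kernel composition of landed modules BY NAME; nothing here
is a claim about the Yang–Mills mass gap

PDF held: `paper:balaban1985-cmp102-variational-background` (journal page = PDF page + 276).

CITATION HEADER (lean-in-tree rule 2026-08-18) / WHAT IS REPRODUCED.  Cell `pub-ymgap`, Track A node N07 = [B11], prover seat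
`pub-ymgap-dag-n07-a` (KNIT-BY-NAME), fourth module; a VARIANT of reader r08's `B11Prop7Assembly` §5–§7 (which it imports and does not
modify) answering the seat's typed finding F5 (dossier `HOME/pub-ymgap-dag-n07-a/N07-KNIT.md`): r08's located leaves
`ExistenceLeaves(Cap).crit112 ∕ axial18 ∕ minimal142` are typed for ALL ε₁, ε₂ > 0, while the assembly invokes them only at ε₁ ≤ a′₁ and
ε₂ = O(1)C₁B₃ε₁; here the same three located sentences are HYPOTHESES RESTRICTED TO ε₁, ε₂ ≤ c (explicit ∀-statements, no new structure),
and the assembly is re-run with a′₁ ↦ min{a₄/(2B₀C₁B₃), e₅/(O₂O₁C₁B₃), c, c/(O₁C₁B₃)}.  NO definition is introduced (theorems only).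
§1 `exists_minimalOrbit_of_prop6_thr`: clause (ii) of Proposition 7 («If ε₁ ≦ a′₁, then there exists a minimal orbit in the space (6) with
   ε₀ = O(1)C₁B₃ε₁») from `B11.Prop6Printed` and the thresholded leaves (p. 296 after (122), p. 299 before (141)).
§2 `prop7From14_of_props_thr` (background-dependent form, both clauses; clause (i) = r08's `B11Prop7Assembly.atMostOneCriticalOrbit_of_props`
   BY NAME), `prop7Printed_of_props_thr` (the typed statement of record `B11.Prop7Printed B₃ C₁ famP`, with the Sect. A law (12)–(14) only for
   ε₁ ≤ a — the inductive hypothesis's range — and constants a₀ ↦ min{a₀, B₃a}, a′₁ ↦ min{a′₁, a}), `thm1Printed_of_props_thr`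
   (`B11.thm1_of_prop7_prop8_sectF` BY NAME).
§3 `thr_of_existenceLeavesCap`: r08's unthresholded leaves give the thresholded hypotheses at every c (so every consumer of
   `ExistenceLeavesCap` is a consumer of this module); `b11Leaf_of_parts_thr`, `b11_main_of_parts_thr`: the B11 leaf `DagBinding.B11Leaf Z`
   and the node `Dag.B11_main (leavesP w P)` at a run bound to `Z`, from Props 2, 3, 4, 5, 6, 8, Sect. F, Prop 9 + the dictionary with
   THRESHOLDED leaves (the form honest lattice instances can be expected to meet).
HONEST SCOPE.  Propositions 2, 5, 6, 8, Sect. F, Prop 9, the bridge laws (15)–(18) and the three located steps are INPUTS (typed statements ∕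
located sentences, never asserted); «minimal orbit» is the carrier's primitive (LOCAL reading, cell GAPS G-B11-E5g); the thresholds are
the printed «sufficiently small» of pp. 289, 296–299 made explicit as ONE constant c.  Count-neutral Track-A bookkeeping; NOT a discharge of
N07 (the B11 group is FREE at NODE 00 Stages 1–3); one finite T⁴ programme at fixed ε; Bałaban AS PRINTED with locators; nothing
continuum ∕ ℝ⁴ ∕ OS ∕ mass-gap ∕ Clay.
-/

namespace Literature.MathematicalPhysics.QuantumFieldTheory.Balaban1983to89.B11Prop7AssemblyThresholds

open Literature.MathematicalPhysics.QuantumFieldTheory.Balaban1983to89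
open Literature.MathematicalPhysics.QuantumFieldTheory.Balaban1983to89.B11
open Literature.MathematicalPhysics.QuantumFieldTheory.Balaban1983to89.DagBinding
open Literature.MathematicalPhysics.QuantumFieldTheory.Balaban1983to89.B11Prop7Assembly (Bridge ExistenceLeavesCap)

variable {I : Type}

/-! ## §1. Clause (ii) of Proposition 7 with thresholded located leaves -/

/-- **Proposition 7, clause (ii), ASSEMBLED with THRESHOLDED leaves** («If ε₁ ≦ a′₁, then there exists a minimal orbit in the space (6)
with ε₀ = O(1)C₁B₃ε₁», p. 299): from `B11.Prop6Printed` (p. 296: *"Equation (111) has a solution belonging to the space (115) with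
ε₄ = 2B₀C₁B₃ε₁, if 2B₀C₁B₃ε₁ ≦ a₄. This solution determines a critical configuration U₁ by the transformation (112)"*) and the located steps
(112) ↦ critical U₁ ∈ (19)–(21) with ε₂ = O₁C₁B₃ε₁ (`crit112`, for ε₁ ≤ c), axial gauge + «Proposition 7 [6]» ↦ U_k ∈ (18) critical with
ε₀ = O₂ε₂ (`axial18`, for ε₁, ε₂ ≤ c), (141)–(142) ↦ minimal in 𝔘(e), e ≤ e₅ (`minimal142`, for ε₁ ≤ c); with
a′₁ = min{a₄/(2B₀C₁B₃), e₅/(O₂O₁C₁B₃), c, c/(O₁C₁B₃)} and O(1) = O₂·O₁. [cite: Balaban1985Variational, Prop. 7 p.299; p.296; (112) p.294; (123)–(142) pp.296–299] -/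
theorem exists_minimalOrbit_of_prop6_thr {famP : I → VarProblemX} {famD : I → LGData}
    (β : ∀ i, Bridge (famP i) (famD i)) {B₀ B₃ C₁ O₁ O₂ e₅ c : ℝ}
    (crit112 : ∀ (i : I) (ε₁ : ℝ) (V : (famP i).Bdry) (U₀ : (famD i).Cfg) (A₁ : (famD i).Fld), 0 < ε₁ → ε₁ ≤ c →
      (famD i).Sat14 (C₁ * B₃ * ε₁) (C₁ * ε₁) ((β i).bdry V) U₀ → (famD i).Sol111 ((β i).bdry V) U₀ A₁ →
      (famD i).nMax U₀ A₁ < 3 * B₀ * C₁ * B₃ * ε₁ →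
        (famD i).CritL ((β i).bdry V) U₀ ((famD i).T112 ((β i).bdry V) U₀ A₁) ∧
          (famD i).In19_21 (O₁ * C₁ * B₃ * ε₁) ((β i).bdry V) U₀ ((famD i).T112 ((β i).bdry V) U₀ A₁))
    (axial18 : ∀ (i : I) (ε₁ ε₂ : ℝ) (V : (famP i).Bdry) (U₀ : (famD i).Cfg) (U₁ : (famD i).Pert),
      0 < ε₁ → ε₁ ≤ c → 0 < ε₂ → ε₂ ≤ c →
      (famD i).Sat14 (C₁ * B₃ * ε₁) (C₁ * ε₁) ((β i).bdry V) U₀ → (famD i).In19_21 ε₂ ((β i).bdry V) U₀ U₁ →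
      (famD i).CritL ((β i).bdry V) U₀ U₁ →
        ∃ u : (famD i).GT, (famD i).Restricted U₀ u ∧ (famP i).InU (O₂ * ε₂) ((β i).emb U₀ ((famD i).toAxial U₀ U₁ u)) ∧
          (famP i).InB V ((β i).emb U₀ ((famD i).toAxial U₀ U₁ u)) ∧
          (famP i).IsCritical V ((β i).emb U₀ ((famD i).toAxial U₀ U₁ u)))
    (minimal142 : ∀ (i : I) (e ε₁ : ℝ) (V : (famP i).Bdry) (U₀ : (famD i).Cfg) (U₁ : (famD i).Pert) (u : (famD i).GT),
      e ≤ e₅ → 0 < ε₁ → ε₁ ≤ c →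
      (famD i).Sat14 (C₁ * B₃ * ε₁) (C₁ * ε₁) ((β i).bdry V) U₀ → (famD i).CritL ((β i).bdry V) U₀ U₁ →
      (famD i).Restricted U₀ u → (famP i).InU e ((β i).emb U₀ ((famD i).toAxial U₀ U₁ u)) →
      (famP i).InB V ((β i).emb U₀ ((famD i).toAxial U₀ U₁ u)) → (famP i).IsCritical V ((β i).emb U₀ ((famD i).toAxial U₀ U₁ u)) →
        (famP i).OnMinimalOrbit e V ((β i).emb U₀ ((famD i).toAxial U₀ U₁ u)))
    (hB₀ : 0 < B₀) (hB₃ : 0 < B₃) (hC₁ : 0 < C₁) (hO₁ : 0 < O₁) (hO₂ : 0 < O₂) (he₅ : 0 < e₅) (hc : 0 < c)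
    (h6 : Prop6Printed B₀ B₃ C₁ famD) :
    ∃ a₁' O : ℝ, 0 < a₁' ∧ 0 < O ∧ ∀ i : I, ∀ ε₁ : ℝ, 0 < ε₁ → ε₁ ≤ a₁' →
      ∀ (V : (famP i).Bdry) (U₀ : (famD i).Cfg), (famD i).Sat14 (C₁ * B₃ * ε₁) (C₁ * ε₁) ((β i).bdry V) U₀ →
        ∃ U : (famP i).Cfg, (famP i).OnMinimalOrbit (O * C₁ * B₃ * ε₁) V U := by
  obtain ⟨a₄, ha₄, H6⟩ := h6
  have hK : 0 < 2 * B₀ * C₁ * B₃ := by positivity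
  have hK' : 0 < O₂ * O₁ * C₁ * B₃ := by positivity
  have hK'' : 0 < O₁ * C₁ * B₃ := by positivity
  refine ⟨min (min (a₄ / (2 * B₀ * C₁ * B₃)) (e₅ / (O₂ * O₁ * C₁ * B₃))) (min c (c / (O₁ * C₁ * B₃))), O₂ * O₁,
    lt_min (lt_min (div_pos ha₄ hK) (div_pos he₅ hK')) (lt_min hc (div_pos hc hK'')), mul_pos hO₂ hO₁, ?_⟩
  intro i ε₁ hε₁ hε₁a V U₀ h14
  have h_a₄ : ε₁ ≤ a₄ / (2 * B₀ * C₁ * B₃) := hε₁a.trans ((min_le_left _ _).trans (min_le_left _ _))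
  have h_e₅ : ε₁ ≤ e₅ / (O₂ * O₁ * C₁ * B₃) := hε₁a.trans ((min_le_left _ _).trans (min_le_right _ _))
  have h_c : ε₁ ≤ c := hε₁a.trans ((min_le_right _ _).trans (min_le_left _ _))
  have h_c' : ε₁ ≤ c / (O₁ * C₁ * B₃) := hε₁a.trans ((min_le_right _ _).trans (min_le_right _ _))
  -- p. 296: Prop. 6 at ε₄ = a₄, «if 2B₀C₁B₃ε₁ ≦ a₄»
  have h2B : 2 * B₀ * C₁ * B₃ * ε₁ ≤ a₄ := by
    have := (le_div_iff₀ hK).1 h_a₄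
    linarith
  -- the cap: O₂O₁C₁B₃ε₁ ≤ e₅
  have hcap : O₂ * (O₁ * C₁ * B₃ * ε₁) ≤ e₅ := by
    have := (le_div_iff₀ hK').1 h_e₅
    linarith
  -- the threshold for ε₂ = O₁C₁B₃ε₁
  have hε₂pos : 0 < O₁ * C₁ * B₃ * ε₁ := by positivity
  have hε₂c : O₁ * C₁ * B₃ * ε₁ ≤ c := by
    have := (le_div_iff₀ hK'').1 h_c'
    linarith
  obtain ⟨⟨A₁, _, hsol, hA₁, _⟩, _, _⟩ := H6 i ε₁ a₄ hε₁ le_rfl h2B ((β i).bdry V) U₀ h14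
  obtain ⟨hcritL, h19⟩ := crit112 i ε₁ V U₀ A₁ hε₁ h_c h14 hsol hA₁
  obtain ⟨u, hu, hInU, hInB, hcrit⟩ :=
    axial18 i ε₁ (O₁ * C₁ * B₃ * ε₁) V U₀ ((famD i).T112 ((β i).bdry V) U₀ A₁) hε₁ h_c hε₂pos hε₂c h14 h19 hcritL
  have hmin := minimal142 i (O₂ * (O₁ * C₁ * B₃ * ε₁)) ε₁ V U₀ ((famD i).T112 ((β i).bdry V) U₀ A₁) u
    hcap hε₁ h_c h14 hcritL hu hInU hInB hcrit
  have hO : O₂ * O₁ * C₁ * B₃ * ε₁ = O₂ * (O₁ * C₁ * B₃ * ε₁) := by ring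
  rw [hO]
  exact ⟨_, hmin⟩

/-! ## §2. Proposition 7 (both clauses), the typed statement of record, Theorem 1 -/

/-- **Proposition 7 from Propositions 2, 5, 6 with thresholded leaves — background-dependent form** (shape of `B11Thm1.Prop7From14`):
clause (i) by r08's `B11Prop7Assembly.atMostOneCriticalOrbit_of_props` BY NAME (p. 296 (122)), clause (ii) by §1.
[cite: Balaban1985Variational, Prop. 7 p.299; (122) p.296] -/
theorem prop7From14_of_props_thr {famP : I → VarProblemX} {famD : I → LGData}
    (β : ∀ i, Bridge (famP i) (famD i)) {B₀ B₁ B₃ C₁ c₁ O₁ O₂ e₅ c : ℝ} (laws : ∀ i, (β i).Laws C₁ B₃)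
    (crit112 : ∀ (i : I) (ε₁ : ℝ) (V : (famP i).Bdry) (U₀ : (famD i).Cfg) (A₁ : (famD i).Fld), 0 < ε₁ → ε₁ ≤ c →
      (famD i).Sat14 (C₁ * B₃ * ε₁) (C₁ * ε₁) ((β i).bdry V) U₀ → (famD i).Sol111 ((β i).bdry V) U₀ A₁ →
      (famD i).nMax U₀ A₁ < 3 * B₀ * C₁ * B₃ * ε₁ →
        (famD i).CritL ((β i).bdry V) U₀ ((famD i).T112 ((β i).bdry V) U₀ A₁) ∧
          (famD i).In19_21 (O₁ * C₁ * B₃ * ε₁) ((β i).bdry V) U₀ ((famD i).T112 ((β i).bdry V) U₀ A₁))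
    (axial18 : ∀ (i : I) (ε₁ ε₂ : ℝ) (V : (famP i).Bdry) (U₀ : (famD i).Cfg) (U₁ : (famD i).Pert),
      0 < ε₁ → ε₁ ≤ c → 0 < ε₂ → ε₂ ≤ c →
      (famD i).Sat14 (C₁ * B₃ * ε₁) (C₁ * ε₁) ((β i).bdry V) U₀ → (famD i).In19_21 ε₂ ((β i).bdry V) U₀ U₁ →
      (famD i).CritL ((β i).bdry V) U₀ U₁ →
        ∃ u : (famD i).GT, (famD i).Restricted U₀ u ∧ (famP i).InU (O₂ * ε₂) ((β i).emb U₀ ((famD i).toAxial U₀ U₁ u)) ∧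
          (famP i).InB V ((β i).emb U₀ ((famD i).toAxial U₀ U₁ u)) ∧
          (famP i).IsCritical V ((β i).emb U₀ ((famD i).toAxial U₀ U₁ u)))
    (minimal142 : ∀ (i : I) (e ε₁ : ℝ) (V : (famP i).Bdry) (U₀ : (famD i).Cfg) (U₁ : (famD i).Pert) (u : (famD i).GT),
      e ≤ e₅ → 0 < ε₁ → ε₁ ≤ c →
      (famD i).Sat14 (C₁ * B₃ * ε₁) (C₁ * ε₁) ((β i).bdry V) U₀ → (famD i).CritL ((β i).bdry V) U₀ U₁ →
      (famD i).Restricted U₀ u → (famP i).InU e ((β i).emb U₀ ((famD i).toAxial U₀ U₁ u)) →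
      (famP i).InB V ((β i).emb U₀ ((famD i).toAxial U₀ U₁ u)) → (famP i).IsCritical V ((β i).emb U₀ ((famD i).toAxial U₀ U₁ u)) →
        (famP i).OnMinimalOrbit e V ((β i).emb U₀ ((famD i).toAxial U₀ U₁ u)))
    (hB₀ : 0 < B₀) (hB₁ : 0 < B₁) (hB₃ : 1 ≤ B₃) (hC₁ : 1 ≤ C₁) (hB₀B₁ : B₀ ≤ 4 * B₁) (hc₁ : 0 < c₁)
    (hO₁ : 0 < O₁) (hO₂ : 0 < O₂) (he₅ : 0 < e₅) (hc : 0 < c)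
    (h2 : Prop2Printed B₁ B₃ C₁ c₁ famD) (h5 : Prop5Printed B₁ B₃ C₁ famD) (h6 : Prop6Printed B₀ B₃ C₁ famD) :
    ∃ a₀ a₁' O : ℝ, 0 < a₀ ∧ 0 < a₁' ∧ 0 < O ∧
      ∀ i : I, ∀ ε₀ ε₁ : ℝ, 0 < ε₁ → ∀ V : (famP i).Bdry, (famP i).Reg7 ε₁ V →
        ∀ U₀ : (famD i).Cfg, (famD i).Sat14 (C₁ * B₃ * ε₁) (C₁ * ε₁) ((β i).bdry V) U₀ →
          (ε₀ ≤ a₀ → B₃ * ε₁ ≤ ε₀ → (famP i).AtMostOneCriticalOrbit ε₀ V) ∧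
          (ε₁ ≤ a₁' → ∃ U : (famP i).Cfg, (famP i).OnMinimalOrbit (O * C₁ * B₃ * ε₁) V U) := by
  obtain ⟨a₀, ha₀, HU⟩ := B11Prop7Assembly.atMostOneCriticalOrbit_of_props β laws hB₁ hB₃ hC₁ hB₀B₁ hc₁ h2 h5 h6
  obtain ⟨a₁', O, ha₁', hO, HE⟩ := exists_minimalOrbit_of_prop6_thr β crit112 axial18 minimal142 hB₀
    (lt_of_lt_of_le one_pos hB₃) (lt_of_lt_of_le one_pos hC₁) hO₁ hO₂ he₅ hc h6
  refine ⟨a₀, a₁', O, ha₀, ha₁', hO, fun i ε₀ ε₁ hε₁ V _ U₀ h14 => ⟨?_, ?_⟩⟩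
  · exact fun hε₀a hB₃ε => HU i ε₀ ε₁ hε₁ hε₀a hB₃ε V U₀ h14
  · exact fun hε₁a => HE i ε₁ hε₁ hε₁a V U₀ h14

/-- **The typed statement of record `B11.Prop7Printed B₃ C₁ famP` from Props 2, 5, 6 with thresholded leaves and the Sect. A law for
ε₁ ≤ a** (p. 280 (11)–(14): the background U₀ is Theorem 1 at level k − 1 applied to V₀ — available for small ε₁ only): constants
a₀ ↦ min{a₀, B₃a}, a′₁ ↦ min{a′₁, a} (clause (i) is only invoked under B₃ε₁ ≤ ε₀ ≤ a₀, clause (ii) under ε₁ ≤ a′₁; cell GAPS G-pv12-1).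
[cite: Balaban1985Variational, Prop. 7 p.299; (11)–(14) pp.279–280] -/
theorem prop7Printed_of_props_thr {famP : I → VarProblemX} {famD : I → LGData}
    (β : ∀ i, Bridge (famP i) (famD i)) {B₀ B₁ B₃ C₁ c₁ O₁ O₂ e₅ c a : ℝ} (laws : ∀ i, (β i).Laws C₁ B₃)
    (crit112 : ∀ (i : I) (ε₁ : ℝ) (V : (famP i).Bdry) (U₀ : (famD i).Cfg) (A₁ : (famD i).Fld), 0 < ε₁ → ε₁ ≤ c →
      (famD i).Sat14 (C₁ * B₃ * ε₁) (C₁ * ε₁) ((β i).bdry V) U₀ → (famD i).Sol111 ((β i).bdry V) U₀ A₁ →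
      (famD i).nMax U₀ A₁ < 3 * B₀ * C₁ * B₃ * ε₁ →
        (famD i).CritL ((β i).bdry V) U₀ ((famD i).T112 ((β i).bdry V) U₀ A₁) ∧
          (famD i).In19_21 (O₁ * C₁ * B₃ * ε₁) ((β i).bdry V) U₀ ((famD i).T112 ((β i).bdry V) U₀ A₁))
    (axial18 : ∀ (i : I) (ε₁ ε₂ : ℝ) (V : (famP i).Bdry) (U₀ : (famD i).Cfg) (U₁ : (famD i).Pert),
      0 < ε₁ → ε₁ ≤ c → 0 < ε₂ → ε₂ ≤ c →
      (famD i).Sat14 (C₁ * B₃ * ε₁) (C₁ * ε₁) ((β i).bdry V) U₀ → (famD i).In19_21 ε₂ ((β i).bdry V) U₀ U₁ →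
      (famD i).CritL ((β i).bdry V) U₀ U₁ →
        ∃ u : (famD i).GT, (famD i).Restricted U₀ u ∧ (famP i).InU (O₂ * ε₂) ((β i).emb U₀ ((famD i).toAxial U₀ U₁ u)) ∧
          (famP i).InB V ((β i).emb U₀ ((famD i).toAxial U₀ U₁ u)) ∧
          (famP i).IsCritical V ((β i).emb U₀ ((famD i).toAxial U₀ U₁ u)))
    (minimal142 : ∀ (i : I) (e ε₁ : ℝ) (V : (famP i).Bdry) (U₀ : (famD i).Cfg) (U₁ : (famD i).Pert) (u : (famD i).GT),
      e ≤ e₅ → 0 < ε₁ → ε₁ ≤ c →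
      (famD i).Sat14 (C₁ * B₃ * ε₁) (C₁ * ε₁) ((β i).bdry V) U₀ → (famD i).CritL ((β i).bdry V) U₀ U₁ →
      (famD i).Restricted U₀ u → (famP i).InU e ((β i).emb U₀ ((famD i).toAxial U₀ U₁ u)) →
      (famP i).InB V ((β i).emb U₀ ((famD i).toAxial U₀ U₁ u)) → (famP i).IsCritical V ((β i).emb U₀ ((famD i).toAxial U₀ U₁ u)) →
        (famP i).OnMinimalOrbit e V ((β i).emb U₀ ((famD i).toAxial U₀ U₁ u)))
    (hB₀ : 0 < B₀) (hB₁ : 0 < B₁) (hB₃ : 1 ≤ B₃) (hC₁ : 1 ≤ C₁) (hB₀B₁ : B₀ ≤ 4 * B₁) (hc₁ : 0 < c₁)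
    (hO₁ : 0 < O₁) (hO₂ : 0 < O₂) (he₅ : 0 < e₅) (hc : 0 < c) (ha : 0 < a)
    (hbg : ∀ (i : I) (ε₁ : ℝ) (V : (famP i).Bdry), 0 < ε₁ → ε₁ ≤ a → (famP i).Reg7 ε₁ V →
      ∃ U₀ : (famD i).Cfg, (famD i).Sat14 (C₁ * B₃ * ε₁) (C₁ * ε₁) ((β i).bdry V) U₀)
    (h2 : Prop2Printed B₁ B₃ C₁ c₁ famD) (h5 : Prop5Printed B₁ B₃ C₁ famD) (h6 : Prop6Printed B₀ B₃ C₁ famD) :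
    Prop7Printed B₃ C₁ famP := by
  obtain ⟨a₀, a₁', O, ha₀, ha₁', hO, H⟩ := prop7From14_of_props_thr β laws crit112 axial18 minimal142 hB₀ hB₁ hB₃ hC₁ hB₀B₁
    hc₁ hO₁ hO₂ he₅ hc h2 h5 h6
  have hB₃pos : 0 < B₃ := lt_of_lt_of_le one_pos hB₃
  refine ⟨min a₀ (B₃ * a), min a₁' a, O, lt_min ha₀ (mul_pos hB₃pos ha), lt_min ha₁' ha, hO,
    fun i ε₀ ε₁ hε₁ V hV => ⟨?_, ?_⟩⟩
  · intro hε₀ hB₃ε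
    have hε₁a : ε₁ ≤ a := by
      have h : B₃ * ε₁ ≤ B₃ * a := hB₃ε.trans (hε₀.trans (min_le_right _ _))
      exact le_of_mul_le_mul_left h hB₃pos
    obtain ⟨U₀, h14⟩ := hbg i ε₁ V hε₁ hε₁a hV
    exact (H i ε₀ ε₁ hε₁ V hV U₀ h14).1 (hε₀.trans (min_le_left _ _)) hB₃ε
  · intro hε₁a
    obtain ⟨U₀, h14⟩ := hbg i ε₁ V hε₁ (hε₁a.trans (min_le_right _ _)) hV
    exact (H i ε₀ ε₁ hε₁ V hV U₀ h14).2 (hε₁a.trans (min_le_left _ _))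

/-! ## §3. Compatibility with r08's leaves; the B11 leaf and the node N07 with thresholded leaves -/

/-- r08's unthresholded located leaves `B11Prop7Assembly.ExistenceLeavesCap` give the three thresholded hypotheses of this module at
EVERY threshold c (the restrictions are simply dropped) — so the theorems of §1–§2 generalise `B11Prop7Assembly` §7.
[cite: Balaban1985Variational, (112) p.294, (123)–(142) pp.296–299] -/
theorem thr_of_existenceLeavesCap {P : VarProblemX} {D : LGData} {β : Bridge P D} {B₀ B₃ C₁ O₁ O₂ e₅ : ℝ}
    (h : ExistenceLeavesCap β B₀ B₃ C₁ O₁ O₂ e₅) (c : ℝ) :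
    (∀ (ε₁ : ℝ) (V : P.Bdry) (U₀ : D.Cfg) (A₁ : D.Fld), 0 < ε₁ → ε₁ ≤ c →
      D.Sat14 (C₁ * B₃ * ε₁) (C₁ * ε₁) (β.bdry V) U₀ → D.Sol111 (β.bdry V) U₀ A₁ → D.nMax U₀ A₁ < 3 * B₀ * C₁ * B₃ * ε₁ →
        D.CritL (β.bdry V) U₀ (D.T112 (β.bdry V) U₀ A₁) ∧ D.In19_21 (O₁ * C₁ * B₃ * ε₁) (β.bdry V) U₀ (D.T112 (β.bdry V) U₀ A₁)) ∧
    (∀ (ε₁ ε₂ : ℝ) (V : P.Bdry) (U₀ : D.Cfg) (U₁ : D.Pert), 0 < ε₁ → ε₁ ≤ c → 0 < ε₂ → ε₂ ≤ c →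
      D.Sat14 (C₁ * B₃ * ε₁) (C₁ * ε₁) (β.bdry V) U₀ → D.In19_21 ε₂ (β.bdry V) U₀ U₁ → D.CritL (β.bdry V) U₀ U₁ →
        ∃ u : D.GT, D.Restricted U₀ u ∧ P.InU (O₂ * ε₂) (β.emb U₀ (D.toAxial U₀ U₁ u)) ∧
          P.InB V (β.emb U₀ (D.toAxial U₀ U₁ u)) ∧ P.IsCritical V (β.emb U₀ (D.toAxial U₀ U₁ u))) ∧
    (∀ (e ε₁ : ℝ) (V : P.Bdry) (U₀ : D.Cfg) (U₁ : D.Pert) (u : D.GT), e ≤ e₅ → 0 < ε₁ → ε₁ ≤ c →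
      D.Sat14 (C₁ * B₃ * ε₁) (C₁ * ε₁) (β.bdry V) U₀ → D.CritL (β.bdry V) U₀ U₁ → D.Restricted U₀ u →
      P.InU e (β.emb U₀ (D.toAxial U₀ U₁ u)) → P.InB V (β.emb U₀ (D.toAxial U₀ U₁ u)) →
      P.IsCritical V (β.emb U₀ (D.toAxial U₀ U₁ u)) → P.OnMinimalOrbit e V (β.emb U₀ (D.toAxial U₀ U₁ u))) :=
  ⟨fun ε₁ V U₀ A₁ hε₁ _ => h.crit112 ε₁ V U₀ A₁ hε₁,
    fun ε₁ ε₂ V U₀ U₁ _ _ _ _ => h.axial18 ε₁ ε₂ V U₀ U₁,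
    fun e ε₁ V U₀ U₁ u he _ _ => h.minimal142 e ε₁ V U₀ U₁ u he⟩

section Knit

variable (Z : PrintedCarriers11)

/-- **THE B11 LEAF FROM ITS IRREDUNDANT PRINTED PARTS WITH THRESHOLDED LOCATED LEAVES** (the variant of `B11LeafKnit.b11Leaf_of_parts` that
honest lattice instances can be expected to meet): Props 2, 3, 4, 5, 6, 8, Sect. F, Prop 9 (the module `…B11`'s typed statements) + the
Theorem-1 carrier laws, the bridge famX ↔ famLG with its located laws (15)–(18), the three located existence steps FOR ε₁, ε₂ ≤ c, the
Sect. A law for ε₁ ≤ a, and the printed constant relations ⇒ all ten conjuncts (Prop 7 by `prop7Printed_of_props_thr`, Thm 1 by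
`B11.thm1_of_prop7_prop8_sectF`), for `Z.famV = fun i ↦ (Z.famX i).toVarProblem`. [cite: Balaban1985Variational, Thm 1 p.279, Props 2–9 pp.281–309] -/
theorem b11Leaf_of_parts_thr (β : ∀ i, Bridge (Z.famX i) (Z.famLG i)) {O₁ O₂ e₅ c a : ℝ}
    (laws : ∀ i, (β i).Laws Z.C₁ Z.B₃)
    (crit112 : ∀ (i : Z.I11) (ε₁ : ℝ) (V : (Z.famX i).Bdry) (U₀ : (Z.famLG i).Cfg) (A₁ : (Z.famLG i).Fld), 0 < ε₁ → ε₁ ≤ c →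
      (Z.famLG i).Sat14 (Z.C₁ * Z.B₃ * ε₁) (Z.C₁ * ε₁) ((β i).bdry V) U₀ → (Z.famLG i).Sol111 ((β i).bdry V) U₀ A₁ →
      (Z.famLG i).nMax U₀ A₁ < 3 * Z.B₀ * Z.C₁ * Z.B₃ * ε₁ →
        (Z.famLG i).CritL ((β i).bdry V) U₀ ((Z.famLG i).T112 ((β i).bdry V) U₀ A₁) ∧
          (Z.famLG i).In19_21 (O₁ * Z.C₁ * Z.B₃ * ε₁) ((β i).bdry V) U₀ ((Z.famLG i).T112 ((β i).bdry V) U₀ A₁))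
    (axial18 : ∀ (i : Z.I11) (ε₁ ε₂ : ℝ) (V : (Z.famX i).Bdry) (U₀ : (Z.famLG i).Cfg) (U₁ : (Z.famLG i).Pert),
      0 < ε₁ → ε₁ ≤ c → 0 < ε₂ → ε₂ ≤ c →
      (Z.famLG i).Sat14 (Z.C₁ * Z.B₃ * ε₁) (Z.C₁ * ε₁) ((β i).bdry V) U₀ → (Z.famLG i).In19_21 ε₂ ((β i).bdry V) U₀ U₁ →
      (Z.famLG i).CritL ((β i).bdry V) U₀ U₁ →
        ∃ u : (Z.famLG i).GT, (Z.famLG i).Restricted U₀ u ∧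
          (Z.famX i).InU (O₂ * ε₂) ((β i).emb U₀ ((Z.famLG i).toAxial U₀ U₁ u)) ∧
          (Z.famX i).InB V ((β i).emb U₀ ((Z.famLG i).toAxial U₀ U₁ u)) ∧
          (Z.famX i).IsCritical V ((β i).emb U₀ ((Z.famLG i).toAxial U₀ U₁ u)))
    (minimal142 : ∀ (i : Z.I11) (e ε₁ : ℝ) (V : (Z.famX i).Bdry) (U₀ : (Z.famLG i).Cfg) (U₁ : (Z.famLG i).Pert)
      (u : (Z.famLG i).GT), e ≤ e₅ → 0 < ε₁ → ε₁ ≤ c →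
      (Z.famLG i).Sat14 (Z.C₁ * Z.B₃ * ε₁) (Z.C₁ * ε₁) ((β i).bdry V) U₀ → (Z.famLG i).CritL ((β i).bdry V) U₀ U₁ →
      (Z.famLG i).Restricted U₀ u → (Z.famX i).InU e ((β i).emb U₀ ((Z.famLG i).toAxial U₀ U₁ u)) →
      (Z.famX i).InB V ((β i).emb U₀ ((Z.famLG i).toAxial U₀ U₁ u)) →
      (Z.famX i).IsCritical V ((β i).emb U₀ ((Z.famLG i).toAxial U₀ U₁ u)) →
        (Z.famX i).OnMinimalOrbit e V ((β i).emb U₀ ((Z.famLG i).toAxial U₀ U₁ u)))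
    (plaws : ∀ i, (Z.famX i).Laws)
    (hB₀ : 0 < Z.B₀) (hB₁ : 0 < Z.B₁) (hB₃ : 1 ≤ Z.B₃) (hC₁ : 1 ≤ Z.C₁) (hB₀B₁ : Z.B₀ ≤ 4 * Z.B₁) (hc₁ : 0 < Z.c₁)
    (hO₁ : 0 < O₁) (hO₂ : 0 < O₂) (he₅ : 0 < e₅) (hc : 0 < c) (ha : 0 < a)
    (hbg : ∀ (i : Z.I11) (ε₁ : ℝ) (V : (Z.famX i).Bdry), 0 < ε₁ → ε₁ ≤ a → (Z.famX i).Reg7 ε₁ V →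
      ∃ U₀ : (Z.famLG i).Cfg, (Z.famLG i).Sat14 (Z.C₁ * Z.B₃ * ε₁) (Z.C₁ * ε₁) ((β i).bdry V) U₀)
    (hV : Z.famV = fun i => (Z.famX i).toVarProblem)
    (p2 : Prop2Printed Z.B₁ Z.B₃ Z.C₁ Z.c₁ Z.famLG) (p3 : Prop3Printed Z.C₁ Z.B₃ Z.C₂ Z.C₃ Z.B₀ Z.c1h Z.c₄ Z.δ₀ Z.famLG)
    (p4 : Prop4Printed Z.C₁ Z.B₃ Z.famLG) (p5 : Prop5Printed Z.B₁ Z.B₃ Z.C₁ Z.famLG) (p6 : Prop6Printed Z.B₀ Z.B₃ Z.C₁ Z.famLG)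
    (p8 : Prop8Printed Z.B₃ Z.famX) (sF : SectFPrinted Z.B₃ Z.famX) (p9 : Prop9Printed Z.B₅ Z.C₁ Z.β₀ Z.δ₀ Z.famAn) :
    B11Leaf Z := by
  have p7 : Prop7Printed Z.B₃ Z.C₁ Z.famX :=
    prop7Printed_of_props_thr β laws crit112 axial18 minimal142 hB₀ hB₁ hB₃ hC₁ hB₀B₁ hc₁ hO₁ hO₂ he₅ hc ha hbg p2 p5 p6
  have t1 : Thm1Printed Z.famV := by
    rw [hV]
    exact thm1_of_prop7_prop8_sectF Z.famX Z.B₃ Z.C₁ (lt_of_lt_of_le one_pos hB₃) (lt_of_lt_of_le one_pos hC₁) plaws p7 p8 sF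
  exact ⟨t1, p2, p3, p4, p5, p6, p7, p8, sF, p9⟩

/-- **THE NODE N07 FROM THE PRINTED PARTS WITH THRESHOLDED LEAVES AT A BINDING OF RECORD**: for every binding world and run with
`w.up P = Upstream.ofPrintedAllXPN X Y Z V W`, the inputs of `b11Leaf_of_parts_thr` at the run's B11 group `Z` give `Dag.B11_main (leavesP w P)`
(«b5 → b6 → b7 → b8 → b9 → b11»; the antecedents are not consumed here — `B11LeafKnit` §3 for the b8 edge).  Nothing is discharged (the
group is free at Stages 1–3). [cite: Balaban1985Variational, Thm 1 p.279, Props 2–9 pp.281–309] -/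
theorem b11_main_of_parts_thr (w : WorldP) (P : B12.RunParams) (X : PrintedCarriersR) (Y : PrintedCarriers9X)
    (V : PrintedCarriers14R) (W : PrintedCarriers15) (hP : w.up P = Upstream.ofPrintedAllXPN X Y Z V W)
    (β : ∀ i, Bridge (Z.famX i) (Z.famLG i)) {O₁ O₂ e₅ c a : ℝ}
    (laws : ∀ i, (β i).Laws Z.C₁ Z.B₃)
    (crit112 : ∀ (i : Z.I11) (ε₁ : ℝ) (V : (Z.famX i).Bdry) (U₀ : (Z.famLG i).Cfg) (A₁ : (Z.famLG i).Fld), 0 < ε₁ → ε₁ ≤ c →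
      (Z.famLG i).Sat14 (Z.C₁ * Z.B₃ * ε₁) (Z.C₁ * ε₁) ((β i).bdry V) U₀ → (Z.famLG i).Sol111 ((β i).bdry V) U₀ A₁ →
      (Z.famLG i).nMax U₀ A₁ < 3 * Z.B₀ * Z.C₁ * Z.B₃ * ε₁ →
        (Z.famLG i).CritL ((β i).bdry V) U₀ ((Z.famLG i).T112 ((β i).bdry V) U₀ A₁) ∧
          (Z.famLG i).In19_21 (O₁ * Z.C₁ * Z.B₃ * ε₁) ((β i).bdry V) U₀ ((Z.famLG i).T112 ((β i).bdry V) U₀ A₁))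
    (axial18 : ∀ (i : Z.I11) (ε₁ ε₂ : ℝ) (V : (Z.famX i).Bdry) (U₀ : (Z.famLG i).Cfg) (U₁ : (Z.famLG i).Pert),
      0 < ε₁ → ε₁ ≤ c → 0 < ε₂ → ε₂ ≤ c →
      (Z.famLG i).Sat14 (Z.C₁ * Z.B₃ * ε₁) (Z.C₁ * ε₁) ((β i).bdry V) U₀ → (Z.famLG i).In19_21 ε₂ ((β i).bdry V) U₀ U₁ →
      (Z.famLG i).CritL ((β i).bdry V) U₀ U₁ →
        ∃ u : (Z.famLG i).GT, (Z.famLG i).Restricted U₀ u ∧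
          (Z.famX i).InU (O₂ * ε₂) ((β i).emb U₀ ((Z.famLG i).toAxial U₀ U₁ u)) ∧
          (Z.famX i).InB V ((β i).emb U₀ ((Z.famLG i).toAxial U₀ U₁ u)) ∧
          (Z.famX i).IsCritical V ((β i).emb U₀ ((Z.famLG i).toAxial U₀ U₁ u)))
    (minimal142 : ∀ (i : Z.I11) (e ε₁ : ℝ) (V : (Z.famX i).Bdry) (U₀ : (Z.famLG i).Cfg) (U₁ : (Z.famLG i).Pert)
      (u : (Z.famLG i).GT), e ≤ e₅ → 0 < ε₁ → ε₁ ≤ c →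
      (Z.famLG i).Sat14 (Z.C₁ * Z.B₃ * ε₁) (Z.C₁ * ε₁) ((β i).bdry V) U₀ → (Z.famLG i).CritL ((β i).bdry V) U₀ U₁ →
      (Z.famLG i).Restricted U₀ u → (Z.famX i).InU e ((β i).emb U₀ ((Z.famLG i).toAxial U₀ U₁ u)) →
      (Z.famX i).InB V ((β i).emb U₀ ((Z.famLG i).toAxial U₀ U₁ u)) →
      (Z.famX i).IsCritical V ((β i).emb U₀ ((Z.famLG i).toAxial U₀ U₁ u)) →
        (Z.famX i).OnMinimalOrbit e V ((β i).emb U₀ ((Z.famLG i).toAxial U₀ U₁ u)))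
    (plaws : ∀ i, (Z.famX i).Laws)
    (hB₀ : 0 < Z.B₀) (hB₁ : 0 < Z.B₁) (hB₃ : 1 ≤ Z.B₃) (hC₁ : 1 ≤ Z.C₁) (hB₀B₁ : Z.B₀ ≤ 4 * Z.B₁) (hc₁ : 0 < Z.c₁)
    (hO₁ : 0 < O₁) (hO₂ : 0 < O₂) (he₅ : 0 < e₅) (hc : 0 < c) (ha : 0 < a)
    (hbg : ∀ (i : Z.I11) (ε₁ : ℝ) (V : (Z.famX i).Bdry), 0 < ε₁ → ε₁ ≤ a → (Z.famX i).Reg7 ε₁ V →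
      ∃ U₀ : (Z.famLG i).Cfg, (Z.famLG i).Sat14 (Z.C₁ * Z.B₃ * ε₁) (Z.C₁ * ε₁) ((β i).bdry V) U₀)
    (hV : Z.famV = fun i => (Z.famX i).toVarProblem)
    (p2 : Prop2Printed Z.B₁ Z.B₃ Z.C₁ Z.c₁ Z.famLG) (p3 : Prop3Printed Z.C₁ Z.B₃ Z.C₂ Z.C₃ Z.B₀ Z.c1h Z.c₄ Z.δ₀ Z.famLG)
    (p4 : Prop4Printed Z.C₁ Z.B₃ Z.famLG) (p5 : Prop5Printed Z.B₁ Z.B₃ Z.C₁ Z.famLG) (p6 : Prop6Printed Z.B₀ Z.B₃ Z.C₁ Z.famLG)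
    (p8 : Prop8Printed Z.B₃ Z.famX) (sF : SectFPrinted Z.B₃ Z.famX) (p9 : Prop9Printed Z.B₅ Z.C₁ Z.β₀ Z.δ₀ Z.famAn) :
    Dag.B11_main (leavesP w P) := by
  show (w.up P).b5 → (w.up P).b6 → (w.up P).b7 → (w.up P).b8 → (w.up P).b9 → (w.up P).b11
  rw [hP]
  exact fun _ _ _ _ _ => b11Leaf_of_parts_thr Z β laws crit112 axial18 minimal142 plaws hB₀ hB₁ hB₃ hC₁ hB₀B₁ hc₁ hO₁ hO₂ he₅
    hc ha hbg hV p2 p3 p4 p5 p6 p8 sF p9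

end Knit

end Literature.MathematicalPhysics.QuantumFieldTheory.Balaban1983to89.B11Prop7AssemblyThresholds
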